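import Summits.KontsevichZagierPeriods.Zeta5Search.TwoTaleOmega.OmegaPlugAEF
import Summits.KontsevichZagierPeriods.Zeta5Search.Denom.TwoTaleP15Coincidence

/-!
# (bmiss)@Ω — Zudilin's two-tale identity on the whole parameter region Ω, a KERNEL THEOREM (cell `pub-zeta5`, cert-2 gen 5)

HONEST FRAMING: systematic search; recurrence certificates; no irrationality claim unless certified.  No named fact, no
`sorry`; this file only assembles tree theorems.

`U_zero_on_Omega`: the two hinge forms `U1 = q + q̂`, `U0 = p + p̂` (`TwoTaleOmega.Pt.U1/U0`) vanish at every point of the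
region `Ω` of `Certificates.TwoTaleTelescope` — by cert-2 g4's rule induction `eq_on_Omega_rule` (every rule step certified,
`CertU`), with
* the BASE (1908 points, `Base`) enumerated in the kernel (`TwoTaleOmegaBaseEnum/BaseTable`) and evaluated exactly
  (`OmegaBaseValues.U_zero_of_base`);
* the rule steps in the directions `b, e, f, g, bg` = cert-1's certified order-5 recurrences (`OmegaPlug5`), direction `a` =
  cert-1's `StepA`, and the diagonal direction `aef` = the generic certificate-parametric step `StepAEFL/StepAEFRKit/StepAEFR/
  StepAEF` instantiated at the 81 shape families of `TwoTaleOmegaAefTable` from fam-tele's telescoping certificates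
  (`AefInst0..26`, `AefPlug0..6`, dispatcher `OmegaPlugAEF.hstepAEF`).

Consequences (all hypothesis-free):
* `bmiss_on_Omega`: (bmiss) `q = −q̂ ∧ p = −p̂` at every `p ∈ Ω` with `d(p) ≥ 0`;
* `pCoincidence_P15`: the `p`-half of the two-tale coincidence at Zudilin's P15 parameters for ALL `n ≥ 1` — the input `hP`
  of `TwoTaleP15Endgame` ("expected to be true" and stated as a conjecture in [Zudilin2014ZetaTwo, (19)]; PROVED IN PRINT
  by [Marcovecchio2020, Thm 3.7] — this file is an independent machine-checked proof by a different route);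
* `inclusion_holds`: fam-denom's input I1 `Denom.TwoTaleP15Forms.Inclusion` (tagged `@[conjecture]` in the tree) is a theorem;
* `integralT_holds`: `Denom.TwoTaleP15Coincidence.IntegralT` (`D₁₆ₙD₁₅ₙ p̂_n ∈ ℤ`, tagged `@[conjecture]`, "not in print");
* the inclusion route of `TwoTaleP15Endgame` is unconditional: `TwoTaleP15.zetaTwo_exponent_le_of_pCoincidence pCoincidence_P15 :
  ExponentLE (zetaValue 2) 5.0499 ∧ zetaTwo_irrationalityExponent_le` — NOT restated as a theorem here (the statement is already a
  tree theorem, `TwoTaleP15MeasureLegs.zetaTwo_exponent_le_P15_flat` and `TwoTaleP15Measure.zetaTwo_exponent_le_P15`; no new bound).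
-/

noncomputable section

open Filter Finset
open Literature.NumberTheory.Irrationality.Zudilin2014
open Summit.KontsevichZagierPeriods.Zeta5Search.FormalBarnes
open Summit.KontsevichZagierPeriods.Zeta5Search.Certificates.TwoTaleTelescope

namespace Summit.KontsevichZagierPeriods.Zeta5Search.TwoTaleOmega

/-- **The hinge forms vanish on Ω**: `U1 (ofVec q) = 0 ∧ U0 (ofVec q) = 0` for every `q ∈ Ω`. -/
theorem U_zero_on_Omega : ∀ q ∈ Certificates.TwoTaleTelescope.Omega, (ofVec q).U1 = 0 ∧ (ofVec q).U0 = 0 :=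
  U_zero_on_Omega_of_aef hstepAEF_U1

/-- **(bmiss)@Ω**: Zudilin's two-tale identity `q = −q̂ ∧ p = −p̂` (`Pt.Bmiss`) at every point of Ω with `d ≥ 0`. -/
theorem bmiss_on_Omega (p : Pt) (hp : p.Omega) (hd : 0 ≤ p.dInt) : p.Bmiss :=
  bmiss_on_Omega_of_aef hstepAEF_U1 p hp hd

/-- **The `p`-coincidence at P15 for all `n ≥ 1`**: `p(aP15 n, bP15 n) = −p̂(aT n, bT n)`. -/
theorem pCoincidence_P15 :
    ∀ n : ℕ, 1 ≤ n → formP (TwoTaleP15.aP15 n) (TwoTaleP15.bP15 n) = -formPT (TwoTaleP15.aT n) (TwoTaleP15.bT n) :=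
  hP_of_aef hstepAEF_U1

/-- **Input I1 of fam-denom is a theorem**: `Denom.TwoTaleP15Forms.Inclusion`. -/
theorem inclusion_holds : Denom.TwoTaleP15Forms.Inclusion :=
  TwoTaleP15.inclusion_of_pCoincidence pCoincidence_P15

/-- **`IntegralT` is a theorem**: `D₁₆ₙD₁₅ₙ p̂_n ∈ ℤ` for every `n ≥ 1` (`p̂_n = −p_n` and `D₁₆ₙD₁₅ₙ p_n = pP15num n ∈ ℤ`). -/
theorem integralT_holds : Denom.TwoTaleP15Coincidence.IntegralT := by
  refine Filter.eventually_atTop.2 ⟨1, fun n hn => ⟨-TwoTaleP15.pP15num n, ?_⟩⟩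
  have h := pCoincidence_P15 n hn
  rw [TwoTaleP15.formP_eq_formP hn] at h
  have e : formPT (TwoTaleP15.aT n) (TwoTaleP15.bT n) = -Denom.TwoTaleP15Forms.formP n := by linarith
  rw [e, mul_neg, TwoTaleP15.pP15num_eq_formP hn, Int.cast_neg]

end Summit.KontsevichZagierPeriods.Zeta5Search.TwoTaleOmega

end
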